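import Summits.Parity.GeneralizedHardyLittlewood.Theorems.LiouvilleMADTypeIIToLevelEngine2
import Summits.Parity.GeneralizedHardyLittlewood.Theorems.LiouvilleMADTypeIIToLevelTypeIIRect
import Literature.NumberTheory.LFunctions.LiouvilleSumClassicalBound

/-!
# `TypeIIToLevel` (route `LiouvilleMAD`), part 5: one modulus, and the real bookkeeping

Support file for the item stmt-Parity-14996
(`Summit.Parity.GeneralizedHardyLittlewood.Theses.LiouvilleMAD.TypeIIToLevel`).

* `abs_corr_class_le`: the Vaughan engine (parts 1–2) applied to the class weight
  `lam_q(n) = 1[n ≡ w (q)] λ(n + h)` at a height `y ≤ N`, with the rectangle type-II hypothesis supplied by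
  `typeII_rect` (part 3) from the `TypeIILiouville`-shaped dyadic bound, and an abstract type-I budget `F q ·`.
* `collect_le`: the pure real-variable bookkeeping that turns the trivial and type-II contributions, summed
  over `q ≤ Q = ⌊N^{ε₀}⌋`, into `≪ N (log N)^{−A}` (parameters `U = ⌊N^{1/10}⌋`, `K = ⌈N^{η'/20}⌉`,
  `T = C_τ N^{η'/100}`, `ε₀ = η'/100`, `η' = min(η, 1/2)`).
-/

noncomputable section

open Finset Real ArithmeticFunction
open Literature.NumberTheory.LFunctions.LiouvilleSum (abs_liouville_le_one)

namespace Summit.Parity.GeneralizedHardyLittlewood.Theorems.TypeIIToLevel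

/-! ### The bound for one modulus -/

/-- **One modulus.**  With the parameters `U ≥ 2` (`U ≤ N ≤ U 2^J`), `K ≥ 1`, a divisor bound `T ≥ 1` on
`[1, N]`, a type-I budget `F q ·` valid up to the height `X ≥ N + h`, and the dyadic bilinear bound for
`Φ = λ(· + h)` with constant `C ≥ 0` and exponent `η > 0`: for `q ≥ 1`, any residue `w` and any height
`y ≤ N`,
`|∑_{n ≤ y, n ≡ w (q)} Λ(n) λ(n+h)| ≤ U log U + 4 log N ∑_{d ≤ U²} F q d
   + J (K (log N · T · W_q · N) + log N · T (N/K + N/U))`, `W_q = (10C+1) q ((U/2)^{−η'} + U^{−η'})`,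
`η' = min η 1/2`. [this line] -/
theorem abs_corr_class_le {h : ℤ} {η C : ℝ} (hη : 0 < η) (hC : 0 ≤ C)
    (hΦ : ∀ M N : ℕ, 1 ≤ N → N ≤ M → ∀ α β : ℕ → ℝ,
      |∑ m ∈ Ioc M (2 * M), ∑ n ∈ Ioc N (2 * N),
          α m * β n * (liouville (Int.toNat (((m * n : ℕ) : ℤ) + h)) : ℝ)| ≤
        C * Real.sqrt (∑ m ∈ Ioc M (2 * M), α m ^ 2) * Real.sqrt (∑ n ∈ Ioc N (2 * N), β n ^ 2) *
          (Real.sqrt ((M : ℝ) * N) * ((N : ℝ) ^ (-(1 / 2 : ℝ)) + (M : ℝ) ^ (-η))))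
    {N X U K J : ℕ} {T : ℝ} (hU : 2 ≤ U) (hUN : U ≤ N) (hJ : N ≤ U * 2 ^ J) (hK : 0 < K) (hT1 : 1 ≤ T)
    (hT : ∀ n, n ≤ N → ((Nat.divisors n).card : ℝ) ≤ T) (hX : (N : ℤ) + h ≤ X)
    (F : ℕ → ℕ → ℝ) (hF0 : ∀ q d, 0 ≤ F q d)
    (hF : ∀ q d w t : ℕ, 1 ≤ q → 1 ≤ d → ((d * t : ℕ) : ℤ) + h ≤ X →
      |∑ m ∈ Ioc 0 t, (if d * m ≡ w [MOD q] then
        (liouville (Int.toNat (((d * m : ℕ) : ℤ) + h)) : ℝ) else 0)| ≤ F q d)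
    {q : ℕ} (hq : 1 ≤ q) (w : ℕ) {y : ℕ} (hy : y ≤ N) :
    |∑ n ∈ (Icc 1 y).filter (fun n : ℕ => n ≡ w [MOD q]),
        ArithmeticFunction.vonMangoldt n * (liouville (Int.toNat ((n : ℤ) + h)) : ℝ)| ≤
      U * Real.log U + 4 * Real.log N * ∑ d ∈ Icc 1 (U * U), F q d +
        J * (K * (Real.log N * T * ((10 * C + 1) * q * ((((U / 2 : ℕ) : ℝ)) ^ (-(min η (1 / 2))) +
          (U : ℝ) ^ (-(min η (1 / 2))))) * N) + Real.log N * T * ((N : ℝ) / K + (N : ℝ) / U)) := by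
  -- the class weight
  set lam : ℕ → ℝ := fun n => if n ≡ w [MOD q] then (liouville (Int.toNat ((n : ℤ) + h)) : ℝ) else 0
    with hlam
  have hlam1 : ∀ n, |lam n| ≤ 1 := by
    intro n; simp only [hlam]; split_ifs
    · exact abs_liouville_le_one _
    · simp
  have hconv : ∑ n ∈ (Icc 1 y).filter (fun n : ℕ => n ≡ w [MOD q]),
      ArithmeticFunction.vonMangoldt n * (liouville (Int.toNat ((n : ℤ) + h)) : ℝ) =
      ∑ n ∈ Ioc 0 y, ArithmeticFunction.vonMangoldt n * lam n := by
    rw [sum_filter, show (Icc 1 y : Finset ℕ) = Ioc 0 y from rfl]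
    refine sum_congr rfl fun n _ => ?_
    simp only [hlam]; split_ifs <;> simp
  rw [hconv]
  -- the hypotheses of the engine at the cut-off `y`
  set W : ℝ := (10 * C + 1) * q * ((((U / 2 : ℕ) : ℝ)) ^ (-(min η (1 / 2))) + (U : ℝ) ^ (-(min η (1 / 2))))
    with hW
  have hW0 : 0 ≤ W := by positivity
  have hI : ∀ d t : ℕ, 1 ≤ d → d ≤ U * U → t ≤ y / d → |∑ m ∈ Ioc 0 t, lam (d * m)| ≤ F q d := by
    intro d t hd _ ht
    have hdt : d * t ≤ N := le_trans (Nat.mul_le_mul_left d ht) ((Nat.mul_div_le y d).trans hy)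
    have hX' : ((d * t : ℕ) : ℤ) + h ≤ X := by
      have : ((d * t : ℕ) : ℤ) ≤ N := by exact_mod_cast hdt
      linarith
    exact hF q d w t hq hd hX'
  have hΦ1 : ∀ k : ℕ, |(liouville (Int.toNat ((k : ℤ) + h)) : ℝ)| ≤ 1 := fun k => abs_liouville_le_one _
  have hΦ' : ∀ M N : ℕ, 1 ≤ N → N ≤ M → ∀ α β : ℕ → ℝ,
      |∑ m ∈ Ioc M (2 * M), ∑ n ∈ Ioc N (2 * N),
          α m * β n * (fun k : ℕ => (liouville (Int.toNat ((k : ℤ) + h)) : ℝ)) (m * n)| ≤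
        C * Real.sqrt (∑ m ∈ Ioc M (2 * M), α m ^ 2) * Real.sqrt (∑ n ∈ Ioc N (2 * N), β n ^ 2) *
          (Real.sqrt ((M : ℝ) * N) * ((N : ℝ) ^ (-(1 / 2 : ℝ)) + (M : ℝ) ^ (-η))) := by
    intro M N' hN hNM α β
    simpa only [Nat.cast_mul] using hΦ M N' hN hNM α β
  have hII := typeII_rect (Φ := fun k : ℕ => (liouville (Int.toNat ((k : ℤ) + h)) : ℝ)) hη hC hΦ1 hΦ'
    hq w hU
  have hmaster := abs_sum_vonMangoldt_mul_le_param (lam := lam) (x := y) (U := U) (F := F q) (W := W)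
    hI (hF0 q) (fun D₁ D₂ N' h1 h2 h3 h4 A B hA hB a b ha hb => by
      simpa only [hlam, Nat.cast_mul] using hII D₁ D₂ N' h1 h2 h3 h4 A B hA hB a b ha hb)
    hW0 hlam1 hU hK (hy.trans hJ) hT1 (fun n hn => hT n (hn.trans hy))
  refine hmaster.trans ?_
  -- weaken `y ↦ N`, `log U ↦ log N`, `∑_{d ≤ U} ↦ ∑_{d ≤ U²}`
  have hU0 : (0 : ℝ) < U := by exact_mod_cast (by omega : 0 < U)
  have hlogU : Real.log U ≤ Real.log N := Real.log_le_log hU0 (by exact_mod_cast hUN)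
  have hlogN : 0 ≤ Real.log N := Real.log_natCast_nonneg N
  have hlogy : Real.log y ≤ Real.log N := by
    rcases Nat.eq_zero_or_pos y with rfl | hy0
    · simp [hlogN]
    · exact Real.log_le_log (by exact_mod_cast hy0) (by exact_mod_cast hy)
  have hlogy0 : 0 ≤ Real.log y := Real.log_natCast_nonneg y
  have hS0 : 0 ≤ ∑ d ∈ Ioc 0 (U * U), F q d := sum_nonneg fun d _ => hF0 q d
  have hSU : ∑ d ∈ Ioc 0 U, F q d ≤ ∑ d ∈ Ioc 0 (U * U), F q d :=
    sum_le_sum_of_subset_of_nonneg (Ioc_subset_Ioc_right (Nat.le_mul_self U)) fun d _ _ => hF0 q d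
  have hIcc : ∑ d ∈ Ioc 0 (U * U), F q d = ∑ d ∈ Icc 1 (U * U), F q d := rfl
  have hyN : (y : ℝ) ≤ N := by exact_mod_cast hy
  have hT0 : 0 ≤ T := zero_le_one.trans hT1
  have hK0 : (0 : ℝ) < K := by exact_mod_cast hK
  have h1 : 2 * Real.log y * ∑ d ∈ Ioc 0 U, F q d ≤ 2 * Real.log N * ∑ d ∈ Ioc 0 (U * U), F q d :=
    mul_le_mul (by linarith) hSU (sum_nonneg fun d _ => hF0 q d) (by positivity)
  have h2 : 2 * Real.log U * ∑ d ∈ Ioc 0 (U * U), F q d ≤ 2 * Real.log N * ∑ d ∈ Ioc 0 (U * U), F q d :=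
    mul_le_mul_of_nonneg_right (by linarith) hS0
  have h3 : (J : ℝ) * (K * (Real.log y * T * W * y) + Real.log y * T * ((y : ℝ) / K + (y : ℝ) / U)) ≤
      J * (K * (Real.log N * T * W * N) + Real.log N * T * ((N : ℝ) / K + (N : ℝ) / U)) := by
    refine mul_le_mul_of_nonneg_left (add_le_add ?_ ?_) (Nat.cast_nonneg J)
    · refine mul_le_mul_of_nonneg_left ?_ hK0.le
      exact mul_le_mul (mul_le_mul_of_nonneg_right (mul_le_mul_of_nonneg_right hlogy hT0) hW0) hyN
        (Nat.cast_nonneg y) (by positivity)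
    · exact mul_le_mul (mul_le_mul_of_nonneg_right hlogy hT0) (by gcongr) (by positivity) (by positivity)
  rw [← hIcc]
  linarith

/-! ### Collecting the trivial and type-II terms (pure real inequalities) -/

/-- **Bookkeeping of the trivial and type-II contributions.**  With `P = N^{η'/100}`, `u = N^{1/10}`,
`κ = N^{η'/20}` and the parameters `Q ≤ P`, `U ∈ [u/2, u]` (`U ≤ N`), `V₂ ≥ u/8` (a lower bound for `⌊U/2⌋`),
`K ∈ [κ, 2κ]`, `J ≤ 3 log N`, `T = C_τ P`, the quantity
`Q · (U log U + J (K (L T ((10C+1) Q (V₂^{−η'} + U^{−η'})) N) + L T (N/K + N/U)))` is at most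
`(1 + (96(10C+1)+9) C_τ) N / L^A` as soon as `L^{A+2} ≤ N^{η'/50}` and `L^{A+1} ≤ N^{4/5}` (`L = log N`).
[this line] -/
theorem collect_le {A L Nr P u κ Qr Ur V₂ Kr Jr T Cτ C₂' η' : ℝ}
    (hη'0 : 0 < η') (hη'1 : η' ≤ 1 / 2) (hL0 : 0 < L) (hN1 : 1 ≤ Nr)
    (hP : P = Nr ^ (η' / 100)) (hu : u = Nr ^ (1 / 10 : ℝ)) (hκ : κ = Nr ^ (η' / 20))
    (hQ0 : 0 ≤ Qr) (hQP : Qr ≤ P) (hUr0 : 0 < Ur) (hUu : Ur ≤ u) (hUhalf : u / 2 ≤ Ur) (hUN : Ur ≤ Nr)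
    (hu4 : 4 ≤ u) (hV2 : u / 8 ≤ V₂) (hKκ : κ ≤ Kr) (hK2 : Kr ≤ 2 * κ) (hJ0 : 0 ≤ Jr) (hJle : Jr ≤ 3 * L)
    (hT : T = Cτ * P) (hCτ0 : 0 ≤ Cτ) (hC₂'0 : 0 ≤ C₂') (hL : L = Real.log Nr)
    (hE1 : L ^ (A + 2) ≤ Nr ^ (η' / 50)) (hE2 : L ^ (A + 1) ≤ Nr ^ (4 / 5 : ℝ)) :
    Qr * (Ur * Real.log Ur + Jr * (Kr * (L * T * ((10 * C₂' + 1) * Qr * (V₂ ^ (-η') + Ur ^ (-η'))) * Nr) +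
      L * T * (Nr / Kr + Nr / Ur))) ≤ (1 + (96 * (10 * C₂' + 1) + 9) * Cτ) * Nr / L ^ A := by
  have hN0 : 0 < Nr := by linarith
  have hu0 : 0 < u := by linarith
  have hV20 : 0 < V₂ := by linarith
  have hκ0 : 0 < κ := by rw [hκ]; exact Real.rpow_pos_of_pos hN0 _
  have hκu : κ ≤ u := by rw [hκ, hu]; exact Real.rpow_le_rpow_of_exponent_le hN1 (by linarith)
  have hP1 : 1 ≤ P := by rw [hP]; exact Real.one_le_rpow hN1 (by positivity)
  have hP0 : 0 < P := by linarith
  have hKr0 : 0 < Kr := hκ0.trans_le hKκ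
  have hT0 : 0 ≤ T := by rw [hT]; positivity
  have ePow : ∀ a b : ℝ, Nr ^ a * Nr ^ b = Nr ^ (a + b) := fun a b => (Real.rpow_add hN0 a b).symm
  set V : ℝ := V₂ ^ (-η') with hVdef
  set Y : ℝ := Ur ^ (-η') with hYdef
  have hLA : 0 < L ^ A := Real.rpow_pos_of_pos hL0 A
  have huinv : u ^ (-η') = κ⁻¹ * κ⁻¹ := by
    rw [hu, hκ, ← Real.rpow_mul hN0.le, ← Real.rpow_neg hN0.le, ← Real.rpow_add hN0]
    congr 1; ring
  have hVle : V ≤ 8 * (κ⁻¹ * κ⁻¹) := by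
    have h1 : V ≤ (u / 8) ^ (-η') :=
      Real.rpow_le_rpow_of_nonpos (by positivity) hV2 (by linarith)
    have h2 : (u / 8) ^ (-η') = u ^ (-η') * (8 : ℝ) ^ η' := by
      rw [Real.div_rpow hu0.le (by norm_num), Real.rpow_neg (by norm_num : (0 : ℝ) ≤ 8), div_eq_mul_inv,
        inv_inv]
    have h3 : (8 : ℝ) ^ η' ≤ 8 := by
      calc (8 : ℝ) ^ η' ≤ (8 : ℝ) ^ (1 : ℝ) := Real.rpow_le_rpow_of_exponent_le (by norm_num) (by linarith)
        _ = 8 := Real.rpow_one 8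
    rw [h2, huinv] at h1
    have h4 : 0 ≤ κ⁻¹ * κ⁻¹ := by positivity
    calc V ≤ κ⁻¹ * κ⁻¹ * (8 : ℝ) ^ η' := h1
      _ ≤ κ⁻¹ * κ⁻¹ * 8 := mul_le_mul_of_nonneg_left h3 h4
      _ = 8 * (κ⁻¹ * κ⁻¹) := by ring
  have hYle : Y ≤ 8 * (κ⁻¹ * κ⁻¹) := by
    have h1 : Y ≤ (u / 2) ^ (-η') :=
      Real.rpow_le_rpow_of_nonpos (by positivity) hUhalf (by linarith)
    have h2 : (u / 2) ^ (-η') = u ^ (-η') * (2 : ℝ) ^ η' := by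
      rw [Real.div_rpow hu0.le (by norm_num), Real.rpow_neg (by norm_num : (0 : ℝ) ≤ 2), div_eq_mul_inv,
        inv_inv]
    have h3 : (2 : ℝ) ^ η' ≤ 8 := by
      calc (2 : ℝ) ^ η' ≤ (2 : ℝ) ^ (1 : ℝ) := Real.rpow_le_rpow_of_exponent_le (by norm_num) (by linarith)
        _ = 2 := Real.rpow_one 2
        _ ≤ 8 := by norm_num
    rw [h2, huinv] at h1
    have h4 : 0 ≤ κ⁻¹ * κ⁻¹ := by positivity
    calc Y ≤ κ⁻¹ * κ⁻¹ * (2 : ℝ) ^ η' := h1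
      _ ≤ κ⁻¹ * κ⁻¹ * 8 := mul_le_mul_of_nonneg_left h3 h4
      _ = 8 * (κ⁻¹ * κ⁻¹) := by ring
  have hV0 : 0 ≤ V := by positivity
  have hY0 : 0 ≤ Y := by positivity
  have hKinv : Kr⁻¹ ≤ κ⁻¹ := (inv_le_inv₀ hKr0 hκ0).2 hKκ
  have hUinv : Ur⁻¹ ≤ 2 * κ⁻¹ := by
    have h1 : Ur⁻¹ ≤ (u / 2)⁻¹ := (inv_le_inv₀ hUr0 (by positivity)).2 hUhalf
    have h2 : (u / 2)⁻¹ = 2 * u⁻¹ := by rw [inv_div]; ring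
    have h3 : u⁻¹ ≤ κ⁻¹ := (inv_le_inv₀ hu0 hκ0).2 hκu
    linarith
  -- `P³ / κ = N^{-η'/50}` and the eventual inequalities
  have hP3κ : P * P * P * κ⁻¹ = Nr ^ (-(η' / 50)) := by
    rw [hP, hκ, ← Real.rpow_neg hN0.le, ePow, ePow, ePow]; congr 1; ring
  have hmain2 : L * L * (Nr * Nr ^ (-(η' / 50))) ≤ Nr / L ^ A := by
    have h1 : L ^ (A + 2) * Nr ^ (-(η' / 50)) ≤ 1 := by
      rw [Real.rpow_neg hN0.le]
      have hpos : 0 < Nr ^ (η' / 50) := Real.rpow_pos_of_pos hN0 _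
      rw [← div_eq_mul_inv, div_le_one hpos]; exact hE1
    have hLA2 : L ^ (A + 2) = L ^ A * (L * L) := by
      rw [Real.rpow_add hL0, Real.rpow_two]; ring
    rw [le_div_iff₀ hLA]
    calc L * L * (Nr * Nr ^ (-(η' / 50))) * L ^ A = Nr * (L ^ (A + 2) * Nr ^ (-(η' / 50))) := by
          rw [hLA2]; ring
      _ ≤ Nr * 1 := mul_le_mul_of_nonneg_left h1 hN0.le
      _ = Nr := mul_one _
  have htriv : Qr * (Ur * Real.log Ur) ≤ Nr / L ^ A := by
    have hlogU : Real.log Ur ≤ L := by rw [hL]; exact Real.log_le_log hUr0 hUN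
    have hlogU0 : 0 ≤ Real.log Ur := by
      have : (1 : ℝ) ≤ Ur := by linarith
      exact Real.log_nonneg this
    have h1 : Qr * (Ur * Real.log Ur) ≤ P * (u * L) :=
      mul_le_mul hQP (mul_le_mul hUu hlogU hlogU0 hu0.le) (by positivity) (by positivity)
    have h2 : P * u ≤ Nr ^ (1 / 5 : ℝ) := by
      rw [hP, hu, ePow]; exact Real.rpow_le_rpow_of_exponent_le hN1 (by linarith)
    have h3 : Nr ^ (1 / 5 : ℝ) * L ^ (A + 1) ≤ Nr := by
      calc Nr ^ (1 / 5 : ℝ) * L ^ (A + 1) ≤ Nr ^ (1 / 5 : ℝ) * Nr ^ (4 / 5 : ℝ) :=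
            mul_le_mul_of_nonneg_left hE2 (by positivity)
        _ = Nr := by rw [ePow]; norm_num
    have hLA1 : L ^ (A + 1) = L ^ A * L := by rw [Real.rpow_add hL0, Real.rpow_one]
    rw [le_div_iff₀ hLA]
    calc Qr * (Ur * Real.log Ur) * L ^ A ≤ P * (u * L) * L ^ A := mul_le_mul_of_nonneg_right h1 hLA.le
      _ = (P * u) * L ^ (A + 1) := by rw [hLA1]; ring
      _ ≤ Nr ^ (1 / 5 : ℝ) * L ^ (A + 1) := mul_le_mul_of_nonneg_right h2 (by positivity)
      _ ≤ Nr := h3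
  have hII' : Qr * (Jr * (Kr * (L * T * ((10 * C₂' + 1) * Qr * (V + Y)) * Nr) +
      L * T * (Nr / Kr + Nr / Ur))) ≤
      (96 * (10 * C₂' + 1) + 9) * Cτ * (L * L * (Nr * Nr ^ (-(η' / 50)))) := by
    -- `K (V + Y) ≤ 32/κ`, `1/K + 1/U ≤ 3/κ`
    have hKVY : Kr * (V + Y) ≤ 32 * κ⁻¹ := by
      calc Kr * (V + Y) ≤ (2 * κ) * (16 * (κ⁻¹ * κ⁻¹)) :=
            mul_le_mul hK2 (by linarith) (by positivity) (by positivity)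
        _ = 32 * κ⁻¹ * (κ * κ⁻¹) := by ring
        _ = 32 * κ⁻¹ := by rw [mul_inv_cancel₀ hκ0.ne', mul_one]
    have hfrac : Nr / Kr + Nr / Ur ≤ 3 * κ⁻¹ * Nr := by
      rw [div_eq_mul_inv, div_eq_mul_inv]
      calc Nr * Kr⁻¹ + Nr * Ur⁻¹ ≤ Nr * κ⁻¹ + Nr * (2 * κ⁻¹) :=
            add_le_add (mul_le_mul_of_nonneg_left hKinv hN0.le) (mul_le_mul_of_nonneg_left hUinv hN0.le)
        _ = 3 * κ⁻¹ * Nr := by ring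
    have hA1 : Jr * (Kr * (L * T * ((10 * C₂' + 1) * Qr * (V + Y)) * Nr)) ≤
        3 * L * (L * (Cτ * P) * ((10 * C₂' + 1) * P) * (32 * κ⁻¹) * Nr) := by
      have e1 : Jr * (Kr * (L * T * ((10 * C₂' + 1) * Qr * (V + Y)) * Nr)) =
          Jr * (L * T * ((10 * C₂' + 1) * Qr) * (Kr * (V + Y)) * Nr) := by ring
      rw [e1]
      refine mul_le_mul hJle ?_ (by positivity) (by positivity)
      refine mul_le_mul_of_nonneg_right ?_ hN0.le
      refine mul_le_mul ?_ hKVY (by positivity) (by positivity)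
      rw [hT]
      exact mul_le_mul_of_nonneg_left (mul_le_mul_of_nonneg_left hQP (by positivity)) (by positivity)
    have hA2 : Jr * (L * T * (Nr / Kr + Nr / Ur)) ≤ 3 * L * (L * (Cτ * P) * (3 * κ⁻¹ * Nr)) := by
      refine mul_le_mul hJle ?_ (by positivity) (by positivity)
      rw [hT]; exact mul_le_mul_of_nonneg_left hfrac (by positivity)
    have hQsum : Qr * (Jr * (Kr * (L * T * ((10 * C₂' + 1) * Qr * (V + Y)) * Nr) +
        L * T * (Nr / Kr + Nr / Ur))) ≤
        P * (3 * L * (L * (Cτ * P) * ((10 * C₂' + 1) * P) * (32 * κ⁻¹) * Nr) +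
          3 * L * (L * (Cτ * P) * (3 * κ⁻¹ * Nr))) := by
      rw [mul_add Jr]
      exact mul_le_mul hQP (add_le_add hA1 hA2) (by positivity) (by positivity)
    refine hQsum.trans ?_
    have hPP : P ≤ P * P := le_mul_of_one_le_right (by positivity) hP1
    have hkey : P * (3 * L * (L * (Cτ * P) * ((10 * C₂' + 1) * P) * (32 * κ⁻¹) * Nr) +
        3 * L * (L * (Cτ * P) * (3 * κ⁻¹ * Nr))) =
        (96 * (10 * C₂' + 1)) * Cτ * (L * L * (Nr * (P * P * P * κ⁻¹))) +
          9 * Cτ * (L * L * (Nr * (P * P * κ⁻¹))) := by ring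
    rw [hkey, ← hP3κ]
    have hmono : L * L * (Nr * (P * P * κ⁻¹)) ≤ L * L * (Nr * (P * P * P * κ⁻¹)) := by
      have : P * P * κ⁻¹ ≤ P * P * P * κ⁻¹ := by
        have h0 : 0 ≤ P * κ⁻¹ := by positivity
        calc P * P * κ⁻¹ = P * (P * κ⁻¹) := by ring
          _ ≤ (P * P) * (P * κ⁻¹) := mul_le_mul_of_nonneg_right hPP h0
          _ = P * P * P * κ⁻¹ := by ring
      exact mul_le_mul_of_nonneg_left (mul_le_mul_of_nonneg_left this hN0.le) (by positivity)
    calc 96 * (10 * C₂' + 1) * Cτ * (L * L * (Nr * (P * P * P * κ⁻¹))) + 9 * Cτ * (L * L * (Nr * (P * P * κ⁻¹)))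
        ≤ 96 * (10 * C₂' + 1) * Cτ * (L * L * (Nr * (P * P * P * κ⁻¹))) +
          9 * Cτ * (L * L * (Nr * (P * P * P * κ⁻¹))) :=
          add_le_add le_rfl (mul_le_mul_of_nonneg_left hmono (by positivity))
      _ = (96 * (10 * C₂' + 1) + 9) * Cτ * (L * L * (Nr * (P * P * P * κ⁻¹))) := by ring
  have hCII0 : 0 ≤ (96 * (10 * C₂' + 1) + 9) * Cτ := by positivity
  have h2 := hII'.trans (mul_le_mul_of_nonneg_left hmain2 hCII0)
  rw [mul_add Qr]
  calc Qr * (Ur * Real.log Ur) + Qr * (Jr * (Kr * (L * T * ((10 * C₂' + 1) * Qr * (V + Y)) * Nr) +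
        L * T * (Nr / Kr + Nr / Ur))) ≤ Nr / L ^ A + (96 * (10 * C₂' + 1) + 9) * Cτ * (Nr / L ^ A) :=
        add_le_add htriv h2
    _ = (1 + (96 * (10 * C₂' + 1) + 9) * Cτ) * Nr / L ^ A := by ring

end Summit.Parity.GeneralizedHardyLittlewood.Theorems.TypeIIToLevel

end
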